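import Summits.BirchSwinnertonDyer.BirchSwinnertonDyer.Theorems.CMKolyvaginAtInertTwoGenusDefectShaRungsAtTwo
import Summits.BirchSwinnertonDyer.BirchSwinnertonDyer.Theorems.GenusKolyvaginAtTwoPowDvdShaCardAtTwoRTTwinShaLaddersOfDepthSupplies
import HarnessLib

/-!
# Route `CMKolyvaginAtInertTwo`, crux `CMKolyvaginExactAtInertTwo` (stmt-BirchSwinnertonDyer-24277) —
# Ш-VALUED TWIN LADDERS FROM DEPTH-INDEXED SUPPLIES WITH THE DOUBLE CLAUSE

Seat `bsd-line-cmk2-p1` g20 (cell `bsd-print-cf2`), `--supports stmt-BirchSwinnertonDyer-24277` (helper; closes nothing).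
THEOREMS ONLY (no definition, no named fact, no `sorry`).  BSD is NOT proved by this.

Steps (b)–(c) of the threading of memo `MEMO-genus-triviality.md` §6.2: gk2-p2's greedy rung builders
(`exists_shaFamily_W_of_forall_exists_avoiding(_seed)`, `exists_shaFamily_twin_of_forall_exists_avoiding(_of_divisible)`) and the
two-root-number assembly `twinShaLadders_of_depth_supplies`, re-threaded with the class predicate strengthened by the DOUBLE CLAUSE
(`y = 2y'`, `y'` an eigenclass of the same sign, Selmer at the places of `K` over `d_K`) and the conclusion strengthened to
**`x_i ∈ Ш(W/ℚ)`, `x'_i ∈ Ш(W^{(d_K)}/ℚ)`** (twin in the model `W.quadraticTwist d_K`).  The greedy lemma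
`exists_indepFamilyMod_of_forall_exists_avoiding` is predicate-generic, so only the final descent changes (companion file
`CMKolyvaginAtInertTwoGenusDefectShaRungsAtTwo`).

* §1 the four rung builders `exists_shaFamilyQ_W_of_forall_exists_avoiding_of_double(_seed)`,
  `exists_shaFamilyQ_twist_of_forall_exists_avoiding_of_double(_of_divisible)`;
* §2 `twinShaLaddersQ_of_depth_supplies_of_double` — both root numbers.

References: [McCallumLMS1991] §5 p. 285, Prop. 5.2, Thm. 5.4 (p. 310); [GrossLMS1991] §5 (5.1), Prop. 5.4;
[DokchitserDokchitserAnnals2010] Lemma 4.14.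
-/

set_option autoImplicit false
-- the Theorems namespace of this sub repeats the summit name by design (D-0017 nested layout)
set_option linter.dupNamespace false

noncomputable section

open scoped Classical

namespace Summit.BirchSwinnertonDyer.BirchSwinnertonDyer.Theorems.KolyvaginGenusTwo

open WeierstrassCurve NumberField IsDedekindDomain Field Rat.HeightOneSpectrum AddSubgroup
open Literature.NumberTheory.EllipticCurves Literature.NumberTheory.GaloisRepresentations
open Summit.BirchSwinnertonDyer.BirchSwinnertonDyer.Theorems.GenusExact
open Summit.BirchSwinnertonDyer.BirchSwinnertonDyer.Theorems.GenusExact.PlusDescent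

variable (W : WeierstrassCurve ℚ) [W.IsElliptic] (K : Type) [Field K] [NumberField K]
  (h2 : Module.finrank ℚ K = 2) (σ : K ≃ₐ[ℚ] K) (hσ : σ ≠ 1) (L : ℕ)

/-! ## §1 The four rung builders with the double clause -/

include h2 hσ in
/-- **Rung of the `W`-ladder IN `Ш(W/ℚ)`, rank-zero side, plain avoidance** (`W(ℚ)` `2^L`-divisible, `E(K)[2^L] = 0`, empty real
condition, (desc-fin) off `d_K`), classes FIXED, Selmer, doubles of fixed classes Selmer at `d_K`.
[cite: McCallumLMS1991, §5 Prop. 5.2, Thm. 5.4 (p. 310)] [cite: DokchitserDokchitserAnnals2010, Lemma 4.14 (proof)] -/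
theorem exists_shaFamilyQ_W_of_forall_exists_avoiding_of_double
    (hdivQ : ∀ P : W.toAffine.Point, ∃ Q : W.toAffine.Point, ((2 ^ L : ℕ) : ℤ) • Q = P)
    (hL : ∀ P : (W.baseChange K).toAffine.Point, ((2 ^ L : ℕ) : ℤ) • P = 0 → P = 0)
    (hinf : ∀ v : InfinitePlace ℚ, selmerLocalKer W v.Completion ((2 ^ L : ℕ) : ℤ) = ⊤)
    (hoff : ∀ (v : HeightOneSpectrum (𝓞 ℚ)) (ξ : galH1Torsion W ((2 ^ L : ℕ) : ℤ)), ¬ ((primesEquiv v : ℕ) : ℤ) ∣ NumberField.discr K →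
      (∀ w : HeightOneSpectrum (𝓞 K), w.under (𝓞 ℚ) = v →
        resTorsion W K ((2 ^ L : ℕ) : ℤ) ξ ∈ selmerLocalKer (W.baseChange K) (w.adicCompletion K) ((2 ^ L : ℕ) : ℤ)) →
      ξ ∈ selmerLocalKer W (v.adicCompletion ℚ) ((2 ^ L : ℕ) : ℤ)) {s a : ℕ}
    (havoid : ∀ i < s, ∀ u : Fin i → galH1Torsion (W.baseChange K) ((2 ^ L : ℕ) : ℤ),
      (∀ k, (u k ∈ selmerGroup (W.baseChange K) ((2 ^ L : ℕ) : ℤ) ∧ conjAct W σ ((2 ^ L : ℕ) : ℤ) (u k) = u k) ∧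
        ∃ u' : galH1Torsion (W.baseChange K) ((2 ^ L : ℕ) : ℤ), u k = 2 • u' ∧ conjAct W σ ((2 ^ L : ℕ) : ℤ) u' = u' ∧
          ∀ w : HeightOneSpectrum (𝓞 K), ((NumberField.discr K : ℤ) : 𝓞 K) ∈ w.asIdeal →
            u' ∈ selmerLocalKer (W.baseChange K) (w.adicCompletion K) ((2 ^ L : ℕ) : ℤ)) →
      (∀ k, addOrderOf (u k) = 2 ^ a) →
      ∃ y : galH1Torsion (W.baseChange K) ((2 ^ L : ℕ) : ℤ),
        ((y ∈ selmerGroup (W.baseChange K) ((2 ^ L : ℕ) : ℤ) ∧ conjAct W σ ((2 ^ L : ℕ) : ℤ) y = y) ∧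
          ∃ y' : galH1Torsion (W.baseChange K) ((2 ^ L : ℕ) : ℤ), y = 2 • y' ∧ conjAct W σ ((2 ^ L : ℕ) : ℤ) y' = y' ∧
            ∀ w : HeightOneSpectrum (𝓞 K), ((NumberField.discr K : ℤ) : 𝓞 K) ∈ w.asIdeal →
              y' ∈ selmerLocalKer (W.baseChange K) (w.adicCompletion K) ((2 ^ L : ℕ) : ℤ)) ∧
        addOrderOf y = 2 ^ a ∧ Disjoint (zmultiples y) (AddSubgroup.closure (Set.range u))) :
    ∃ x : Fin s → W.galH1, (∀ i, x i ∈ W.sha) ∧ (∀ i, addOrderOf (x i) = 2 ^ a) ∧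
      ∀ e : Fin s → ℤ, ∑ i, e i • x i = 0 → ∀ i, ((2 ^ a : ℕ) : ℤ) ∣ e i := by
  have hn : ((2 ^ L : ℕ) : ℤ) ≠ 0 := by positivity
  obtain ⟨z, hP, hord, hind⟩ := exists_indepFamilyMod_of_forall_exists_avoiding (N := 2 ^ a) (s := s)
    (fun y : galH1Torsion (W.baseChange K) ((2 ^ L : ℕ) : ℤ) ↦
      (y ∈ selmerGroup (W.baseChange K) ((2 ^ L : ℕ) : ℤ) ∧ conjAct W σ ((2 ^ L : ℕ) : ℤ) y = y) ∧
        ∃ y' : galH1Torsion (W.baseChange K) ((2 ^ L : ℕ) : ℤ), y = 2 • y' ∧ conjAct W σ ((2 ^ L : ℕ) : ℤ) y' = y' ∧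
          ∀ w : HeightOneSpectrum (𝓞 K), ((NumberField.discr K : ℤ) : 𝓞 K) ∈ w.asIdeal →
            y' ∈ selmerLocalKer (W.baseChange K) (w.adicCompletion K) ((2 ^ L : ℕ) : ℤ)) ⊥
    (fun i hi u hPu hordu _ ↦ by
      obtain ⟨y, hPy, hy, hdisj⟩ := havoid i hi u hPu hordu
      exact ⟨y, hPy, hy, dvd_of_zsmul_add_sum_mem_of_disjoint ⊥ u hy (by rwa [sup_bot_eq])⟩)
  exact exists_shaFamilyQ_of_fixed_selmerFamily_of_double_of_injective W K h2 σ hσ _ hL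
    (torsionH1ToH1_injective_of_divisible W hn (by convert hdivQ)) hinf hoff z (fun i ↦ (hP i).1.1) (fun i ↦ (hP i).1.2)
    (fun i ↦ (hP i).2) hord (indep_of_indepMod ⊥ z (by exact_mod_cast hind))

include h2 hσ in
/-- **Rung of the `W`-ladder IN `Ш(W/ℚ)`, Mordell–Weil side, seed `⟨δ(P₀)⟩`** (`g` generating `E(K)` mod `2^L`, `2^L ∤ P₀`),
classes fixed, Selmer, doubles of fixed classes Selmer at `d_K`. [cite: McCallumLMS1991, §5 Prop. 5.2, Thm. 5.4 (p. 310)]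
[cite: DokchitserDokchitserAnnals2010, Lemma 4.14 (proof)] -/
theorem exists_shaFamilyQ_W_of_forall_exists_avoiding_of_double_seed
    (hdiv : ∀ P : geomPoints (W.baseChange K), ∃ Q : geomPoints (W.baseChange K), ((2 ^ L : ℕ) : ℤ) • Q = P)
    (hL : ∀ P : (W.baseChange K).toAffine.Point, ((2 ^ L : ℕ) : ℤ) • P = 0 → P = 0)
    (hinf : ∀ v : InfinitePlace ℚ, selmerLocalKer W v.Completion ((2 ^ L : ℕ) : ℤ) = ⊤)
    (hoff : ∀ (v : HeightOneSpectrum (𝓞 ℚ)) (ξ : galH1Torsion W ((2 ^ L : ℕ) : ℤ)), ¬ ((primesEquiv v : ℕ) : ℤ) ∣ NumberField.discr K →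
      (∀ w : HeightOneSpectrum (𝓞 K), w.under (𝓞 ℚ) = v →
        resTorsion W K ((2 ^ L : ℕ) : ℤ) ξ ∈ selmerLocalKer (W.baseChange K) (w.adicCompletion K) ((2 ^ L : ℕ) : ℤ)) →
      ξ ∈ selmerLocalKer W (v.adicCompletion ℚ) ((2 ^ L : ℕ) : ℤ))
    (g : (W.baseChange K).toAffine.Point)
    (hg : ∀ P : (W.baseChange K).toAffine.Point, ∃ (k : ℤ) (Q : (W.baseChange K).toAffine.Point),
      ((2 ^ L : ℕ) : ℤ) • Q = P - k • g)
    (P₀ : (W.baseChange K).toAffine.Point) (hP₀ : ∀ Q : (W.baseChange K).toAffine.Point, ((2 ^ L : ℕ) : ℤ) • Q ≠ P₀)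
    {s a : ℕ}
    (havoid : ∀ i < s, ∀ u : Fin i → galH1Torsion (W.baseChange K) ((2 ^ L : ℕ) : ℤ),
      (∀ k, (u k ∈ selmerGroup (W.baseChange K) ((2 ^ L : ℕ) : ℤ) ∧ conjAct W σ ((2 ^ L : ℕ) : ℤ) (u k) = u k) ∧
        ∃ u' : galH1Torsion (W.baseChange K) ((2 ^ L : ℕ) : ℤ), u k = 2 • u' ∧ conjAct W σ ((2 ^ L : ℕ) : ℤ) u' = u' ∧
          ∀ w : HeightOneSpectrum (𝓞 K), ((NumberField.discr K : ℤ) : 𝓞 K) ∈ w.asIdeal →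
            u' ∈ selmerLocalKer (W.baseChange K) (w.adicCompletion K) ((2 ^ L : ℕ) : ℤ)) →
      (∀ k, addOrderOf (u k) = 2 ^ a) →
      ∃ y : galH1Torsion (W.baseChange K) ((2 ^ L : ℕ) : ℤ),
        ((y ∈ selmerGroup (W.baseChange K) ((2 ^ L : ℕ) : ℤ) ∧ conjAct W σ ((2 ^ L : ℕ) : ℤ) y = y) ∧
          ∃ y' : galH1Torsion (W.baseChange K) ((2 ^ L : ℕ) : ℤ), y = 2 • y' ∧ conjAct W σ ((2 ^ L : ℕ) : ℤ) y' = y' ∧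
            ∀ w : HeightOneSpectrum (𝓞 K), ((NumberField.discr K : ℤ) : 𝓞 K) ∈ w.asIdeal →
              y' ∈ selmerLocalKer (W.baseChange K) (w.adicCompletion K) ((2 ^ L : ℕ) : ℤ)) ∧
        addOrderOf y = 2 ^ a ∧
        Disjoint (zmultiples y) (AddSubgroup.closure (Set.range u) ⊔
          zmultiples (kummerMapTorsion (W.baseChange K) ((2 ^ L : ℕ) : ℤ) hdiv P₀))) :
    ∃ x : Fin s → W.galH1, (∀ i, x i ∈ W.sha) ∧ (∀ i, addOrderOf (x i) = 2 ^ a) ∧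
      ∀ e : Fin s → ℤ, ∑ i, e i • x i = 0 → ∀ i, ((2 ^ a : ℕ) : ℤ) ∣ e i := by
  set C₀ : AddSubgroup (galH1Torsion (W.baseChange K) ((2 ^ L : ℕ) : ℤ)) :=
    zmultiples (kummerMapTorsion (W.baseChange K) ((2 ^ L : ℕ) : ℤ) hdiv P₀) with hC₀
  obtain ⟨z, hP, hord, hind⟩ := exists_indepFamilyMod_of_forall_exists_avoiding (N := 2 ^ a) (s := s)
    (fun y : galH1Torsion (W.baseChange K) ((2 ^ L : ℕ) : ℤ) ↦
      (y ∈ selmerGroup (W.baseChange K) ((2 ^ L : ℕ) : ℤ) ∧ conjAct W σ ((2 ^ L : ℕ) : ℤ) y = y) ∧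
        ∃ y' : galH1Torsion (W.baseChange K) ((2 ^ L : ℕ) : ℤ), y = 2 • y' ∧ conjAct W σ ((2 ^ L : ℕ) : ℤ) y' = y' ∧
          ∀ w : HeightOneSpectrum (𝓞 K), ((NumberField.discr K : ℤ) : 𝓞 K) ∈ w.asIdeal →
            y' ∈ selmerLocalKer (W.baseChange K) (w.adicCompletion K) ((2 ^ L : ℕ) : ℤ)) C₀
    (fun i hi u hPu hordu _ ↦ by
      obtain ⟨y, hPy, hy, hdisj⟩ := havoid i hi u hPu hordu
      exact ⟨y, hPy, hy, dvd_of_zsmul_add_sum_mem_of_disjoint C₀ u hy hdisj⟩)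
  have hdisj : Disjoint (AddSubgroup.closure (Set.range z)) C₀ := disjoint_closure_range_of_indepMod C₀ z hord hind
  have hker := sum_zsmul_eq_zero_of_torsionH1ToH1_eq_zero_of_disjoint_kummer (W.baseChange K) hdiv g hg P₀ hP₀ z hdisj
  exact exists_shaFamilyQ_of_fixed_selmerFamily_of_double W K h2 σ hσ _ hL hinf hoff z (fun i ↦ (hP i).1.1) (fun i ↦ (hP i).1.2)
    (fun i ↦ (hP i).2) hker hord (indep_of_indepMod C₀ z (by exact_mod_cast hind))

omit [W.IsElliptic] in
include h2 hσ in
/-- **Rung of the `W^{(d_K)}`-ladder IN `Ш(W^{(d_K)}/ℚ)`, Mordell–Weil side, seed `⟨δ(P₀)⟩`**, classes ANTI-FIXED, Selmer, doubles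
of anti-fixed classes Selmer at `d_K`; twin `W.quadraticTwist d_K` with empty real condition and (desc-fin) off `d_K`.
[cite: McCallumLMS1991, §5 Prop. 5.2, Thm. 5.4 (p. 310)] [cite: GrossLMS1991, §5 (5.1), Prop. 5.4] [cite: DokchitserDokchitserAnnals2010, Lemma 4.14 (proof)] -/
theorem exists_shaFamilyQ_twist_of_forall_exists_avoiding_of_double [(W.quadraticTwist (NumberField.discr K : ℚ)).IsElliptic]
    (hdiv : ∀ P : geomPoints (W.baseChange K), ∃ Q : geomPoints (W.baseChange K), ((2 ^ L : ℕ) : ℤ) • Q = P)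
    (hL : ∀ P : (W.baseChange K).toAffine.Point, ((2 ^ L : ℕ) : ℤ) • P = 0 → P = 0)
    (hinf : ∀ v : InfinitePlace ℚ, selmerLocalKer (W.quadraticTwist (NumberField.discr K : ℚ)) v.Completion ((2 ^ L : ℕ) : ℤ) = ⊤)
    (hoff : ∀ (v : HeightOneSpectrum (𝓞 ℚ)) (ξ : galH1Torsion (W.quadraticTwist (NumberField.discr K : ℚ)) ((2 ^ L : ℕ) : ℤ)),
      ¬ ((primesEquiv v : ℕ) : ℤ) ∣ NumberField.discr K →
      (∀ w : HeightOneSpectrum (𝓞 K), w.under (𝓞 ℚ) = v →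
        resTorsion (W.quadraticTwist (NumberField.discr K : ℚ)) K ((2 ^ L : ℕ) : ℤ) ξ ∈
          selmerLocalKer ((W.quadraticTwist (NumberField.discr K : ℚ)).baseChange K) (w.adicCompletion K) ((2 ^ L : ℕ) : ℤ)) →
      ξ ∈ selmerLocalKer (W.quadraticTwist (NumberField.discr K : ℚ)) (v.adicCompletion ℚ) ((2 ^ L : ℕ) : ℤ))
    (g : (W.baseChange K).toAffine.Point)
    (hg : ∀ P : (W.baseChange K).toAffine.Point, ∃ (k : ℤ) (Q : (W.baseChange K).toAffine.Point),
      ((2 ^ L : ℕ) : ℤ) • Q = P - k • g)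
    (P₀ : (W.baseChange K).toAffine.Point) (hP₀ : ∀ Q : (W.baseChange K).toAffine.Point, ((2 ^ L : ℕ) : ℤ) • Q ≠ P₀)
    {s a : ℕ}
    (havoid : ∀ i < s, ∀ u : Fin i → galH1Torsion (W.baseChange K) ((2 ^ L : ℕ) : ℤ),
      (∀ k, (u k ∈ selmerGroup (W.baseChange K) ((2 ^ L : ℕ) : ℤ) ∧ conjAct W σ ((2 ^ L : ℕ) : ℤ) (u k) = -u k) ∧
        ∃ u' : galH1Torsion (W.baseChange K) ((2 ^ L : ℕ) : ℤ), u k = 2 • u' ∧ conjAct W σ ((2 ^ L : ℕ) : ℤ) u' = -u' ∧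
          ∀ w : HeightOneSpectrum (𝓞 K), ((NumberField.discr K : ℤ) : 𝓞 K) ∈ w.asIdeal →
            u' ∈ selmerLocalKer (W.baseChange K) (w.adicCompletion K) ((2 ^ L : ℕ) : ℤ)) →
      (∀ k, addOrderOf (u k) = 2 ^ a) →
      ∃ y : galH1Torsion (W.baseChange K) ((2 ^ L : ℕ) : ℤ),
        ((y ∈ selmerGroup (W.baseChange K) ((2 ^ L : ℕ) : ℤ) ∧ conjAct W σ ((2 ^ L : ℕ) : ℤ) y = -y) ∧
          ∃ y' : galH1Torsion (W.baseChange K) ((2 ^ L : ℕ) : ℤ), y = 2 • y' ∧ conjAct W σ ((2 ^ L : ℕ) : ℤ) y' = -y' ∧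
            ∀ w : HeightOneSpectrum (𝓞 K), ((NumberField.discr K : ℤ) : 𝓞 K) ∈ w.asIdeal →
              y' ∈ selmerLocalKer (W.baseChange K) (w.adicCompletion K) ((2 ^ L : ℕ) : ℤ)) ∧
        addOrderOf y = 2 ^ a ∧
        Disjoint (zmultiples y) (AddSubgroup.closure (Set.range u) ⊔
          zmultiples (kummerMapTorsion (W.baseChange K) ((2 ^ L : ℕ) : ℤ) hdiv P₀))) :
    ∃ y : Fin s → (W.quadraticTwist (NumberField.discr K : ℚ)).galH1,
      (∀ i, y i ∈ (W.quadraticTwist (NumberField.discr K : ℚ)).sha) ∧ (∀ i, addOrderOf (y i) = 2 ^ a) ∧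
      ∀ e : Fin s → ℤ, ∑ i, e i • y i = 0 → ∀ i, ((2 ^ a : ℕ) : ℤ) ∣ e i := by
  set C₀ : AddSubgroup (galH1Torsion (W.baseChange K) ((2 ^ L : ℕ) : ℤ)) :=
    zmultiples (kummerMapTorsion (W.baseChange K) ((2 ^ L : ℕ) : ℤ) hdiv P₀) with hC₀
  obtain ⟨z, hP, hord, hind⟩ := exists_indepFamilyMod_of_forall_exists_avoiding (N := 2 ^ a) (s := s)
    (fun y : galH1Torsion (W.baseChange K) ((2 ^ L : ℕ) : ℤ) ↦
      (y ∈ selmerGroup (W.baseChange K) ((2 ^ L : ℕ) : ℤ) ∧ conjAct W σ ((2 ^ L : ℕ) : ℤ) y = -y) ∧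
        ∃ y' : galH1Torsion (W.baseChange K) ((2 ^ L : ℕ) : ℤ), y = 2 • y' ∧ conjAct W σ ((2 ^ L : ℕ) : ℤ) y' = -y' ∧
          ∀ w : HeightOneSpectrum (𝓞 K), ((NumberField.discr K : ℤ) : 𝓞 K) ∈ w.asIdeal →
            y' ∈ selmerLocalKer (W.baseChange K) (w.adicCompletion K) ((2 ^ L : ℕ) : ℤ)) C₀
    (fun i hi u hPu hordu _ ↦ by
      obtain ⟨y, hPy, hy, hdisj⟩ := havoid i hi u hPu hordu
      exact ⟨y, hPy, hy, dvd_of_zsmul_add_sum_mem_of_disjoint C₀ u hy hdisj⟩)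
  have hdisj : Disjoint (AddSubgroup.closure (Set.range z)) C₀ := disjoint_closure_range_of_indepMod C₀ z hord hind
  have hker := sum_zsmul_eq_zero_of_torsionH1ToH1_eq_zero_of_disjoint_kummer (W.baseChange K) hdiv g hg P₀ hP₀ z hdisj
  exact exists_shaFamilyQ_twist_of_antifixed_selmerFamily_of_double W K h2 σ hσ _ hL hinf hoff z (fun i ↦ (hP i).1.1)
    (fun i ↦ (hP i).1.2) (fun i ↦ (hP i).2) hker hord (indep_of_indepMod C₀ z (by exact_mod_cast hind))

omit [W.IsElliptic] in
include h2 hσ in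
/-- **Rung of the `W^{(d_K)}`-ladder IN `Ш(W^{(d_K)}/ℚ)`, rank-zero side, plain avoidance** (`W^{(d_K)}(ℚ)` `2^L`-divisible),
classes anti-fixed, Selmer, doubles of anti-fixed classes Selmer at `d_K`. [cite: McCallumLMS1991, §5 Prop. 5.2, Thm. 5.4 (p. 310)]
[cite: DokchitserDokchitserAnnals2010, Lemma 4.14 (proof)] -/
theorem exists_shaFamilyQ_twist_of_forall_exists_avoiding_of_double_of_divisible
    [(W.quadraticTwist (NumberField.discr K : ℚ)).IsElliptic]
    (hL : ∀ P : (W.baseChange K).toAffine.Point, ((2 ^ L : ℕ) : ℤ) • P = 0 → P = 0)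
    (hdivXd : ∀ P : (W.quadraticTwist (NumberField.discr K : ℚ)).toAffine.Point,
      ∃ Q : (W.quadraticTwist (NumberField.discr K : ℚ)).toAffine.Point, ((2 ^ L : ℕ) : ℤ) • Q = P)
    (hinf : ∀ v : InfinitePlace ℚ, selmerLocalKer (W.quadraticTwist (NumberField.discr K : ℚ)) v.Completion ((2 ^ L : ℕ) : ℤ) = ⊤)
    (hoff : ∀ (v : HeightOneSpectrum (𝓞 ℚ)) (ξ : galH1Torsion (W.quadraticTwist (NumberField.discr K : ℚ)) ((2 ^ L : ℕ) : ℤ)),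
      ¬ ((primesEquiv v : ℕ) : ℤ) ∣ NumberField.discr K →
      (∀ w : HeightOneSpectrum (𝓞 K), w.under (𝓞 ℚ) = v →
        resTorsion (W.quadraticTwist (NumberField.discr K : ℚ)) K ((2 ^ L : ℕ) : ℤ) ξ ∈
          selmerLocalKer ((W.quadraticTwist (NumberField.discr K : ℚ)).baseChange K) (w.adicCompletion K) ((2 ^ L : ℕ) : ℤ)) →
      ξ ∈ selmerLocalKer (W.quadraticTwist (NumberField.discr K : ℚ)) (v.adicCompletion ℚ) ((2 ^ L : ℕ) : ℤ))
    {s a : ℕ}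
    (havoid : ∀ i < s, ∀ u : Fin i → galH1Torsion (W.baseChange K) ((2 ^ L : ℕ) : ℤ),
      (∀ k, (u k ∈ selmerGroup (W.baseChange K) ((2 ^ L : ℕ) : ℤ) ∧ conjAct W σ ((2 ^ L : ℕ) : ℤ) (u k) = -u k) ∧
        ∃ u' : galH1Torsion (W.baseChange K) ((2 ^ L : ℕ) : ℤ), u k = 2 • u' ∧ conjAct W σ ((2 ^ L : ℕ) : ℤ) u' = -u' ∧
          ∀ w : HeightOneSpectrum (𝓞 K), ((NumberField.discr K : ℤ) : 𝓞 K) ∈ w.asIdeal →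
            u' ∈ selmerLocalKer (W.baseChange K) (w.adicCompletion K) ((2 ^ L : ℕ) : ℤ)) →
      (∀ k, addOrderOf (u k) = 2 ^ a) →
      ∃ y : galH1Torsion (W.baseChange K) ((2 ^ L : ℕ) : ℤ),
        ((y ∈ selmerGroup (W.baseChange K) ((2 ^ L : ℕ) : ℤ) ∧ conjAct W σ ((2 ^ L : ℕ) : ℤ) y = -y) ∧
          ∃ y' : galH1Torsion (W.baseChange K) ((2 ^ L : ℕ) : ℤ), y = 2 • y' ∧ conjAct W σ ((2 ^ L : ℕ) : ℤ) y' = -y' ∧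
            ∀ w : HeightOneSpectrum (𝓞 K), ((NumberField.discr K : ℤ) : 𝓞 K) ∈ w.asIdeal →
              y' ∈ selmerLocalKer (W.baseChange K) (w.adicCompletion K) ((2 ^ L : ℕ) : ℤ)) ∧
        addOrderOf y = 2 ^ a ∧ Disjoint (zmultiples y) (AddSubgroup.closure (Set.range u))) :
    ∃ y : Fin s → (W.quadraticTwist (NumberField.discr K : ℚ)).galH1,
      (∀ i, y i ∈ (W.quadraticTwist (NumberField.discr K : ℚ)).sha) ∧ (∀ i, addOrderOf (y i) = 2 ^ a) ∧
      ∀ e : Fin s → ℤ, ∑ i, e i • y i = 0 → ∀ i, ((2 ^ a : ℕ) : ℤ) ∣ e i := by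
  have hn : ((2 ^ L : ℕ) : ℤ) ≠ 0 := by positivity
  obtain ⟨z, hP, hord, hind⟩ := exists_indepFamilyMod_of_forall_exists_avoiding (N := 2 ^ a) (s := s)
    (fun y : galH1Torsion (W.baseChange K) ((2 ^ L : ℕ) : ℤ) ↦
      (y ∈ selmerGroup (W.baseChange K) ((2 ^ L : ℕ) : ℤ) ∧ conjAct W σ ((2 ^ L : ℕ) : ℤ) y = -y) ∧
        ∃ y' : galH1Torsion (W.baseChange K) ((2 ^ L : ℕ) : ℤ), y = 2 • y' ∧ conjAct W σ ((2 ^ L : ℕ) : ℤ) y' = -y' ∧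
          ∀ w : HeightOneSpectrum (𝓞 K), ((NumberField.discr K : ℤ) : 𝓞 K) ∈ w.asIdeal →
            y' ∈ selmerLocalKer (W.baseChange K) (w.adicCompletion K) ((2 ^ L : ℕ) : ℤ)) ⊥
    (fun i hi u hPu hordu _ ↦ by
      obtain ⟨y, hPy, hy, hdisj⟩ := havoid i hi u hPu hordu
      exact ⟨y, hPy, hy, dvd_of_zsmul_add_sum_mem_of_disjoint ⊥ u hy (by rwa [sup_bot_eq])⟩)
  exact exists_shaFamilyQ_twist_of_antifixed_selmerFamily_of_double_of_divisible W K h2 σ hσ _ hn hL hdivXd hinf hoff z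
    (fun i ↦ (hP i).1.1) (fun i ↦ (hP i).1.2) (fun i ↦ (hP i).2) hord (indep_of_indepMod ⊥ z (by exact_mod_cast hind))

/-! ## §2 The two Ш(·/ℚ)-valued ladders from depth-indexed supplies with the double clause, either root number -/

omit [W.IsElliptic] in
/-- A rung with no drop needs no supply: the zero family lies in `Ш`, has order `2^0`, is independent modulo `2^0`. [folklore] -/
theorem exists_shaFamilyQ_zero (X : WeierstrassCurve ℚ) (s : ℕ) :
    ∃ x : Fin s → X.galH1, (∀ i, x i ∈ X.sha) ∧ (∀ i, addOrderOf (x i) = 2 ^ 0) ∧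
      ∀ e : Fin s → ℤ, ∑ i, e i • x i = 0 → ∀ i, ((2 ^ 0 : ℕ) : ℤ) ∣ e i :=
  ⟨fun _ ↦ 0, fun _ ↦ AddSubgroup.zero_mem _, fun _ ↦ by rw [pow_zero, addOrderOf_zero],
    fun e _ i ↦ by rw [pow_zero, Nat.cast_one]; exact one_dvd _⟩

include h2 hσ in
/-- **THE TWO `Ш(·/ℚ)`-VALUED LADDERS FROM DEPTH-INDEXED SUPPLIES WITH THE DOUBLE CLAUSE, EITHER ROOT NUMBER.** gk2-p2's
`twinShaLadders_of_depth_supplies` (frame at level `2^L` over the quadratic `K`, `σ ≠ 1`: `E(K)[2^L] = 0`, `E(K̄)` `2^L`-divisible,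
`g` generating `E(K)` mod `2^L`, `P₀ ∈ E(K)` with `2^L ∤ P₀`; rank-`0` side keyed to `w(E)`; depth minima `Mr`; supplies at the odd /
even depths of sign `w(E)` / `−w(E)`, the even ones avoiding the seed `⟨δ(P₀)⟩`) with: the twin in the model `W.quadraticTwist d_K`,
the supplied classes carrying the DOUBLE CLAUSE (`y = 2y'`, `y'` of the same sign, Selmer at the places over `d_K`), the real Selmer
conditions of `W` and `W^{(d_K)}` empty and (desc-fin) off `d_K` for both.  THEN the ladders are valued in `Ш(W/ℚ)` and `Ш(W^{(d_K)}/ℚ)`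
(the `hfam`/`hfam'` binders of `two_pow_mul_two_pow_sum_defect_le_of_shaValuedLadders`).
[cite: McCallumLMS1991, §5 p. 285, Prop. 5.2, Thm. 5.4 (p. 310)] [cite: GrossLMS1991, §5 Prop. 5.4] [cite: DokchitserDokchitserAnnals2010, Lemma 4.14 (proof)] -/
theorem twinShaLaddersQ_of_depth_supplies_of_double [(W.quadraticTwist (NumberField.discr K : ℚ)).IsElliptic]
    (hdiv : ∀ P : geomPoints (W.baseChange K), ∃ Q : geomPoints (W.baseChange K), ((2 ^ L : ℕ) : ℤ) • Q = P)
    (hL : ∀ P : (W.baseChange K).toAffine.Point, ((2 ^ L : ℕ) : ℤ) • P = 0 → P = 0)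
    (hinfW : ∀ v : InfinitePlace ℚ, selmerLocalKer W v.Completion ((2 ^ L : ℕ) : ℤ) = ⊤)
    (hoffW : ∀ (v : HeightOneSpectrum (𝓞 ℚ)) (ξ : galH1Torsion W ((2 ^ L : ℕ) : ℤ)), ¬ ((primesEquiv v : ℕ) : ℤ) ∣ NumberField.discr K →
      (∀ w : HeightOneSpectrum (𝓞 K), w.under (𝓞 ℚ) = v →
        resTorsion W K ((2 ^ L : ℕ) : ℤ) ξ ∈ selmerLocalKer (W.baseChange K) (w.adicCompletion K) ((2 ^ L : ℕ) : ℤ)) →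
      ξ ∈ selmerLocalKer W (v.adicCompletion ℚ) ((2 ^ L : ℕ) : ℤ))
    (hinfD : ∀ v : InfinitePlace ℚ, selmerLocalKer (W.quadraticTwist (NumberField.discr K : ℚ)) v.Completion ((2 ^ L : ℕ) : ℤ) = ⊤)
    (hoffD : ∀ (v : HeightOneSpectrum (𝓞 ℚ)) (ξ : galH1Torsion (W.quadraticTwist (NumberField.discr K : ℚ)) ((2 ^ L : ℕ) : ℤ)),
      ¬ ((primesEquiv v : ℕ) : ℤ) ∣ NumberField.discr K →
      (∀ w : HeightOneSpectrum (𝓞 K), w.under (𝓞 ℚ) = v →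
        resTorsion (W.quadraticTwist (NumberField.discr K : ℚ)) K ((2 ^ L : ℕ) : ℤ) ξ ∈
          selmerLocalKer ((W.quadraticTwist (NumberField.discr K : ℚ)).baseChange K) (w.adicCompletion K) ((2 ^ L : ℕ) : ℤ)) →
      ξ ∈ selmerLocalKer (W.quadraticTwist (NumberField.discr K : ℚ)) (v.adicCompletion ℚ) ((2 ^ L : ℕ) : ℤ))
    (hrank0 : (W.rootNumber = 1 ∧ ∀ P : W.toAffine.Point, ∃ Q : W.toAffine.Point, ((2 ^ L : ℕ) : ℤ) • Q = P) ∨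
      (W.rootNumber = -1 ∧ ∀ P : (W.quadraticTwist (NumberField.discr K : ℚ)).toAffine.Point,
        ∃ Q : (W.quadraticTwist (NumberField.discr K : ℚ)).toAffine.Point, ((2 ^ L : ℕ) : ℤ) • Q = P))
    (g : (W.baseChange K).toAffine.Point)
    (hg : ∀ P : (W.baseChange K).toAffine.Point, ∃ (k : ℤ) (Q : (W.baseChange K).toAffine.Point),
      ((2 ^ L : ℕ) : ℤ) • Q = P - k • g)
    (P₀ : (W.baseChange K).toAffine.Point) (hP₀ : ∀ Q : (W.baseChange K).toAffine.Point, ((2 ^ L : ℕ) : ℤ) • Q ≠ P₀)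
    (M₀ R : ℕ) (Mr : ℕ → ℕ) (hMr : ∀ j, Mr (j + 1) ≤ Mr j) (hMr0 : Mr 0 = M₀) (hMrR : Mr R = 0)
    (hsupOdd : ∀ m : ℕ, Mr (2 * m + 1) < Mr (2 * m) →
      ∀ i < 2 * m + 2, ∀ u : Fin i → galH1Torsion (W.baseChange K) ((2 ^ L : ℕ) : ℤ),
      (∀ k, ((u k ∈ selmerGroup (W.baseChange K) ((2 ^ L : ℕ) : ℤ) ∧ conjAct W σ ((2 ^ L : ℕ) : ℤ) (u k) = W.rootNumber • u k) ∧
          ∃ u' : galH1Torsion (W.baseChange K) ((2 ^ L : ℕ) : ℤ), u k = 2 • u' ∧ conjAct W σ ((2 ^ L : ℕ) : ℤ) u' = W.rootNumber • u' ∧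
            ∀ w : HeightOneSpectrum (𝓞 K), ((NumberField.discr K : ℤ) : 𝓞 K) ∈ w.asIdeal →
              u' ∈ selmerLocalKer (W.baseChange K) (w.adicCompletion K) ((2 ^ L : ℕ) : ℤ))) →
      (∀ k, addOrderOf (u k) = 2 ^ (Mr (2 * m) - Mr (2 * m + 1))) →
      ∃ y : galH1Torsion (W.baseChange K) ((2 ^ L : ℕ) : ℤ),
        ((y ∈ selmerGroup (W.baseChange K) ((2 ^ L : ℕ) : ℤ) ∧ conjAct W σ ((2 ^ L : ℕ) : ℤ) y = W.rootNumber • y) ∧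
          ∃ u' : galH1Torsion (W.baseChange K) ((2 ^ L : ℕ) : ℤ), y = 2 • u' ∧ conjAct W σ ((2 ^ L : ℕ) : ℤ) u' = W.rootNumber • u' ∧
            ∀ w : HeightOneSpectrum (𝓞 K), ((NumberField.discr K : ℤ) : 𝓞 K) ∈ w.asIdeal →
              u' ∈ selmerLocalKer (W.baseChange K) (w.adicCompletion K) ((2 ^ L : ℕ) : ℤ)) ∧
        addOrderOf y = 2 ^ (Mr (2 * m) - Mr (2 * m + 1)) ∧ Disjoint (zmultiples y) (AddSubgroup.closure (Set.range u)))
    (hsupEven : ∀ m : ℕ, Mr (2 * m + 2) < Mr (2 * m + 1) →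
      ∀ i < 2 * m + 2, ∀ u : Fin i → galH1Torsion (W.baseChange K) ((2 ^ L : ℕ) : ℤ),
      (∀ k, ((u k ∈ selmerGroup (W.baseChange K) ((2 ^ L : ℕ) : ℤ) ∧ conjAct W σ ((2 ^ L : ℕ) : ℤ) (u k) = (-W.rootNumber) • u k) ∧
          ∃ u' : galH1Torsion (W.baseChange K) ((2 ^ L : ℕ) : ℤ), u k = 2 • u' ∧ conjAct W σ ((2 ^ L : ℕ) : ℤ) u' = (-W.rootNumber) • u' ∧
            ∀ w : HeightOneSpectrum (𝓞 K), ((NumberField.discr K : ℤ) : 𝓞 K) ∈ w.asIdeal →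
              u' ∈ selmerLocalKer (W.baseChange K) (w.adicCompletion K) ((2 ^ L : ℕ) : ℤ))) →
      (∀ k, addOrderOf (u k) = 2 ^ (Mr (2 * m + 1) - Mr (2 * m + 2))) →
      ∃ y : galH1Torsion (W.baseChange K) ((2 ^ L : ℕ) : ℤ),
        ((y ∈ selmerGroup (W.baseChange K) ((2 ^ L : ℕ) : ℤ) ∧ conjAct W σ ((2 ^ L : ℕ) : ℤ) y = (-W.rootNumber) • y) ∧
          ∃ u' : galH1Torsion (W.baseChange K) ((2 ^ L : ℕ) : ℤ), y = 2 • u' ∧ conjAct W σ ((2 ^ L : ℕ) : ℤ) u' = (-W.rootNumber) • u' ∧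
            ∀ w : HeightOneSpectrum (𝓞 K), ((NumberField.discr K : ℤ) : 𝓞 K) ∈ w.asIdeal →
              u' ∈ selmerLocalKer (W.baseChange K) (w.adicCompletion K) ((2 ^ L : ℕ) : ℤ)) ∧
        addOrderOf y = 2 ^ (Mr (2 * m + 1) - Mr (2 * m + 2)) ∧
        Disjoint (zmultiples y) (AddSubgroup.closure (Set.range u) ⊔
          zmultiples (kummerMapTorsion (W.baseChange K) ((2 ^ L : ℕ) : ℤ) hdiv P₀))) :
    ∃ (T : ℕ) (M : ℕ → ℕ), (∀ j, M (j + 1) ≤ M j) ∧ M 0 = M₀ ∧ M (2 * T) = 0 ∧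
      (∀ m < T, ∃ x : Fin (2 * m + 2) → W.galH1, (∀ i, x i ∈ W.sha) ∧
        (∀ i, addOrderOf (x i) = 2 ^ (M (2 * m) - M (2 * m + 1))) ∧
        ∀ c : Fin (2 * m + 2) → ℤ, ∑ i, c i • x i = 0 → ∀ i, ((2 ^ (M (2 * m) - M (2 * m + 1)) : ℕ) : ℤ) ∣ c i) ∧
      (∀ m < T, ∃ x : Fin (2 * m + 2) → (W.quadraticTwist (NumberField.discr K : ℚ)).galH1,
        (∀ i, x i ∈ (W.quadraticTwist (NumberField.discr K : ℚ)).sha) ∧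
        (∀ i, addOrderOf (x i) = 2 ^ (M (2 * m + 1) - M (2 * m + 2))) ∧
        ∀ c : Fin (2 * m + 2) → ℤ, ∑ i, c i • x i = 0 → ∀ i, ((2 ^ (M (2 * m + 1) - M (2 * m + 2)) : ℕ) : ℤ) ∣ c i) := by
  -- antitonicity in the large
  have hanti : ∀ a b, a ≤ b → Mr b ≤ Mr a := fun a b hab ↦ by
    induction hab with
    | refl => exact le_rfl
    | step _ ih => exact (hMr _).trans ih
  have hMr2R : Mr (2 * R) = 0 := Nat.eq_zero_of_le_zero (hMrR ▸ hanti R (2 * R) (by omega))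
  rcases hrank0 with ⟨hw, hdivQ⟩ | ⟨hw, hdivWd⟩
  · /- `w(E) = +1`: odd depths (sign `+1`, no seed) go to `W` (rank 0), even depths (sign `−1`, seed) to the twist; `M := Mr`. -/
    refine ⟨R, Mr, hMr, hMr0, hMr2R, fun m _ ↦ ?_, fun m _ ↦ ?_⟩
    · rcases Nat.eq_zero_or_pos (Mr (2 * m) - Mr (2 * m + 1)) with h0 | hpos
      · rw [h0]; exact exists_shaFamilyQ_zero W _
      · refine exists_shaFamilyQ_W_of_forall_exists_avoiding_of_double W K h2 σ hσ L hdivQ hL hinfW hoffW (s := 2 * m + 2)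
          (a := Mr (2 * m) - Mr (2 * m + 1)) fun i hi u hu hord ↦ ?_
        obtain ⟨y, ⟨⟨hysel, hyτ⟩, y', hyy', hy'τ, hy'sel⟩, hyord, hyav⟩ := hsupOdd m (by omega) i hi u
          (fun k ↦ ⟨⟨(hu k).1.1, by rw [(hu k).1.2, hw, one_smul]⟩, (hu k).2.imp fun u' h ↦
            ⟨h.1, by rw [h.2.1, hw, one_smul], h.2.2⟩⟩) hord
        exact ⟨y, ⟨⟨hysel, by rw [hyτ, hw, one_smul]⟩, y', hyy', by rw [hy'τ, hw, one_smul], hy'sel⟩, hyord, hyav⟩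
    · rcases Nat.eq_zero_or_pos (Mr (2 * m + 1) - Mr (2 * m + 2)) with h0 | hpos
      · rw [h0]; exact exists_shaFamilyQ_zero _ _
      · refine exists_shaFamilyQ_twist_of_forall_exists_avoiding_of_double W K h2 σ hσ L hdiv hL hinfD hoffD g hg P₀ hP₀
          (s := 2 * m + 2) (a := Mr (2 * m + 1) - Mr (2 * m + 2)) fun i hi u hu hord ↦ ?_
        obtain ⟨y, ⟨⟨hysel, hyτ⟩, y', hyy', hy'τ, hy'sel⟩, hyord, hyav⟩ := hsupEven m (by omega) i hi u
          (fun k ↦ ⟨⟨(hu k).1.1, by rw [(hu k).1.2, hw, neg_one_zsmul]⟩, (hu k).2.imp fun u' h ↦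
            ⟨h.1, by rw [h.2.1, hw, neg_one_zsmul], h.2.2⟩⟩) hord
        exact ⟨y, ⟨⟨hysel, by rw [hyτ, hw, neg_one_zsmul]⟩, y', hyy', by rw [hy'τ, hw, neg_one_zsmul], hy'sel⟩, hyord, hyav⟩
  · /- `w(E) = −1`: odd depths (sign `−1`, no seed) go to the twist (rank 0), even depths (sign `+1`, seed) to `W`; interleaved. -/
    let M : ℕ → ℕ := fun j ↦ if j % 2 = 0 then Mr j else Mr (j - 1) - (Mr j - Mr (j + 1))
    have hMeven : ∀ m, M (2 * m) = Mr (2 * m) := fun m ↦ by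
      simp only [M, Nat.mul_mod_right, if_true]
    have hModd : ∀ m, M (2 * m + 1) = Mr (2 * m) - (Mr (2 * m + 1) - Mr (2 * m + 2)) := fun m ↦ by
      have h1 : (2 * m + 1) % 2 = 1 := by omega
      simp only [M, h1, Nat.one_ne_zero, ↓reduceIte, Nat.add_sub_cancel]
    have hdropW : ∀ m, M (2 * m) - M (2 * m + 1) = Mr (2 * m + 1) - Mr (2 * m + 2) := fun m ↦ by
      rw [hMeven, hModd]
      have := hMr (2 * m); have := hMr (2 * m + 1)
      omega
    have hdropWd : ∀ m, M (2 * m + 1) - M (2 * m + 2) = Mr (2 * m) - Mr (2 * m + 1) := fun m ↦ by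
      rw [hModd, show 2 * m + 2 = 2 * (m + 1) by ring, hMeven]
      have := hMr (2 * m); have := hMr (2 * m + 1)
      rw [show 2 * (m + 1) = 2 * m + 1 + 1 by ring]
      omega
    have hManti : ∀ j, M (j + 1) ≤ M j := fun j ↦ by
      rcases Nat.even_or_odd j with ⟨m, rfl⟩ | ⟨m, rfl⟩
      · rw [← two_mul, hModd, hMeven]
        omega
      · rw [show 2 * m + 1 + 1 = 2 * (m + 1) by ring, hMeven, hModd, show 2 * m + 2 = 2 * (m + 1) by ring]
        have := hMr (2 * m); have := hMr (2 * m + 1)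
        rw [show 2 * (m + 1) = 2 * m + 1 + 1 by ring]
        omega
    refine ⟨R, M, hManti, by rw [show (0 : ℕ) = 2 * 0 by ring, hMeven, mul_zero, hMr0], by rw [hMeven, hMr2R],
      fun m _ ↦ ?_, fun m _ ↦ ?_⟩
    · rw [hdropW]
      rcases Nat.eq_zero_or_pos (Mr (2 * m + 1) - Mr (2 * m + 2)) with h0 | hpos
      · rw [h0]; exact exists_shaFamilyQ_zero W _
      · refine exists_shaFamilyQ_W_of_forall_exists_avoiding_of_double_seed W K h2 σ hσ L hdiv hL hinfW hoffW g hg P₀ hP₀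
          (s := 2 * m + 2) (a := Mr (2 * m + 1) - Mr (2 * m + 2)) fun i hi u hu hord ↦ ?_
        obtain ⟨y, ⟨⟨hysel, hyτ⟩, y', hyy', hy'τ, hy'sel⟩, hyord, hyav⟩ := hsupEven m (by omega) i hi u
          (fun k ↦ ⟨⟨(hu k).1.1, by rw [(hu k).1.2, hw, neg_neg, one_smul]⟩, (hu k).2.imp fun u' h ↦
            ⟨h.1, by rw [h.2.1, hw, neg_neg, one_smul], h.2.2⟩⟩) hord
        exact ⟨y, ⟨⟨hysel, by rw [hyτ, hw, neg_neg, one_smul]⟩, y', hyy', by rw [hy'τ, hw, neg_neg, one_smul], hy'sel⟩,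
          hyord, hyav⟩
    · rw [hdropWd]
      rcases Nat.eq_zero_or_pos (Mr (2 * m) - Mr (2 * m + 1)) with h0 | hpos
      · rw [h0]; exact exists_shaFamilyQ_zero _ _
      · refine exists_shaFamilyQ_twist_of_forall_exists_avoiding_of_double_of_divisible W K h2 σ hσ L hL hdivWd hinfD hoffD
          (s := 2 * m + 2) (a := Mr (2 * m) - Mr (2 * m + 1)) fun i hi u hu hord ↦ ?_
        obtain ⟨y, ⟨⟨hysel, hyτ⟩, y', hyy', hy'τ, hy'sel⟩, hyord, hyav⟩ := hsupOdd m (by omega) i hi u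
          (fun k ↦ ⟨⟨(hu k).1.1, by rw [(hu k).1.2, hw, neg_one_zsmul]⟩, (hu k).2.imp fun u' h ↦
            ⟨h.1, by rw [h.2.1, hw, neg_one_zsmul], h.2.2⟩⟩) hord
        exact ⟨y, ⟨⟨hysel, by rw [hyτ, hw, neg_one_zsmul]⟩, y', hyy', by rw [hy'τ, hw, neg_one_zsmul], hy'sel⟩, hyord, hyav⟩

end Summit.BirchSwinnertonDyer.BirchSwinnertonDyer.Theorems.KolyvaginGenusTwo

end
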